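import Mathlib
import Summits.AtomisticToContinuum.Crystallization.Theorems.ReggeStarCoercivityCoercivityForcesZeroDefects
import Summits.AtomisticToContinuum.Crystallization.Theorems.DefectFreeCrystallizes.Negative.PredicateAPI
import Summits.AtomisticToContinuum.Crystallization.Theses.PhononSlackCertificates
import Summits.AtomisticToContinuum.Crystallization.Theorems.PricedLinkCensusCrysEnergyUpper
import Summits.AtomisticToContinuum.Crystallization.Theorems.ReggeStarCoercivityStarCoercivityTwoShellGoodStarGood
import Literature.MathematicalPhysics.StatisticalMechanics.LennardJonesClusters

/-!
# `ZeroDefectDensity` (stmt-AtomisticToContinuum-13604) from the SEPARATED two-shell gap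

Support item `ReggeStarCoercivity.ZeroDefectDensity`: along every sequence of Lennard-Jones ground
states the fraction of `1/20`-defective first shells tends to `0`.  The route derives it from the
crux `StarCoercivity` (13600, all injective configurations); the crux's live line
(`Cruxes/StarCoercivity/Lines/separation-padding-transfer.lean`) reduces 13600 to three stubs:
closest-pair deletion (separation is removable), "two-shell good ⇒ star good", and the SEPARATED
TWO-SHELL GAP (= `PhononSlackCertificates.CoerciveTwoShellGap`, stmt-13956, at `δ = 1/3`).

This file records that FOR THIS ITEM the first stub is not needed: ground states are themselves
`1/3`-separated (`third_le_dist_of_isGroundState`, the explicit constant inside the tree's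
`LennardJonesMinimalDistance_holds`), so coercivity is only ever used on separated configurations.
Sorry-free contents:

* `defects_le_card_not_isTwoShellGood` — `#Def₁(x) ≤ #Bad₂(x)` on injective `x`, from the landed stub
  `SeparationPaddingTransfer.stub_twoShellGoodStarGood` (two-shell good ⇒ star good) of the crux line.
* `third_le_dist_of_isGroundState` — Lennard-Jones ground states in `ℝ³` are `1/3`-separated.
* `tendsto_defects_div_of_sepStarCoercivity` — the crux inequality demanded only of
  `1/3`-SEPARATED injective configurations (entry `SepStarCoercivity` of the line) already gives
  the body of `ZeroDefectDensity` (compose with `zeroDefectDensity_iff.2`; uses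
  `crysEnergyUpper_proof`, item 11865, `BlancLewin2015_8_holds` and the real-analysis squeeze
  `coercivityForcesZeroDefects_squeeze` of the glue file of item 13605).
* `tendsto_defects_div_of_sepTwoShellGap` — the same from the separated two-shell gap with an
  `N^(2/3)` allowance (the statement of the line's stub `stub_separatedTwoShellGap`, verbatim).
* `zeroDefectDensity_of_coerciveTwoShellGap` — `PhononSlackCertificates.CoerciveTwoShellGap →
  ZeroDefectDensity`: item 13604 closes as soon as EITHER 13600 (via
  `zeroDefectDensity_of_starCoercivity` of the sibling reduction file) or 13956 lands, and by
  `zeroDefectDensity_iff.2 (tendsto_defects_div_of_sepTwoShellGap stub_separatedTwoShellGap)` as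
  soon as the crux line's third stub alone lands.
-/

noncomputable section

namespace Summit.AtomisticToContinuum.Crystallization.Theorems.ZeroDefectDensity

open Summit.AtomisticToContinuum.Crystallization.Theses.ReggeStarCoercivity
open Summit.AtomisticToContinuum.Crystallization.Theorems.DefectFreeCrystallizes.Negative.PredicateAPI
open Literature.MathematicalPhysics.StatisticalMechanics Literature.Geometry.DiscreteGeometry
open Filter Topology

/-! ## `#Def₁ ≤ #Bad₂` (two-shell good ⇒ star good, landed stub of the crux line) -/

/-- On an injective configuration the number of star-defective sites is at most the number of
sites that are not two-shell good: `#Def₁(x) ≤ #Bad₂(x)` — pointwise this is the landed stub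
`stub_twoShellGoodStarGood` of the crux line `separation-padding-transfer` (two-shell good at
tolerance `1/20` on the window `[47/50, 1]` ⇒ star good, file
`ReggeStarCoercivityStarCoercivityTwoShellGoodStarGood.lean`). [folklore] -/
theorem defects_le_card_not_isTwoShellGood {N : ℕ} {x : Fin N → EuclideanSpace ℝ (Fin 3)}
    (hx : Function.Injective x) :
    defects x ≤ Nat.card {i : Fin N // ¬ IsTwoShellGood (1 / 20) (47 / 50) 1 x i} := by
  classical
  unfold defects
  rw [Nat.card_eq_fintype_card, Nat.card_eq_fintype_card]
  exact Fintype.card_subtype_mono _ _ fun i hi hgood =>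
    hi (SeparationPaddingTransfer.stub_twoShellGoodStarGood N x i hx hgood)

/-! ## Ground states are `1/3`-separated -/

/-- **Lennard-Jones ground states in `ℝ³` are `1/3`-separated** (the explicit constant of the
tree's discharge `LennardJonesMinimalDistance_holds`, whose statement is only `∃ δ > 0`): at a
closest pair `(i₀, j₀)` of a ground state, `r = |x_{i₀} − x_{j₀}|`, the removal inequality
`𝓔^{i₀}(x) ≤ 0` (`siteEnergy_nonpos_of_isGroundState`) and the shell sum
`∑_{k ≠ i₀} |x_{i₀} − x_k|⁻⁶ ≤ 250 r⁻⁶` (`sum_inv_pow_six_le`) give `r⁻¹² ≤ 500 r⁻⁶`, whence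
`r⁻⁶ ≤ 500 < 3⁶`. [cite: Xue1997, Main Theorem; BlancLewin2015, §2.2] -/
theorem third_le_dist_of_isGroundState {N : ℕ} {x : Fin N → EuclideanSpace ℝ (Fin 3)}
    (hx : IsGroundState lennardJones x) {i j : Fin N} (hij : i ≠ j) :
    (1 / 3 : ℝ) ≤ dist (x i) (x j) := by
  by_contra hlt
  rw [not_le] at hlt
  -- a closest pair `(i₀, j₀)`
  obtain ⟨p, hp, hmin⟩ := Finset.exists_min_image Finset.univ.offDiag
    (fun p : Fin N × Fin N => dist (x p.1) (x p.2)) ⟨(i, j), by simp [hij]⟩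
  obtain ⟨i₀, j₀⟩ := p
  have hij₀ : i₀ ≠ j₀ := by simpa using hp
  set r := dist (x i₀) (x j₀) with hr_def
  have hr : 0 < r := dist_pos.2 (hx.1.ne hij₀)
  have hsep : ∀ k l, k ≠ l → r ≤ dist (x k) (x l) := fun k l hkl => hmin (k, l) (by simp [hkl])
  have hr3 : r < 1 / 3 := (hsep i j hij).trans_lt hlt
  -- the site energy of `i₀`
  have h0 := siteEnergy_nonpos_of_isGroundState (by norm_num) hx i₀
  have hS := sum_inv_pow_six_le x hr hsep i₀
  have h12 : r⁻¹ ^ 12 ≤ ∑ k ∈ Finset.univ.erase i₀, (dist (x i₀) (x k))⁻¹ ^ 12 := by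
    have hj : j₀ ∈ Finset.univ.erase i₀ := Finset.mem_erase.2 ⟨hij₀.symm, Finset.mem_univ _⟩
    exact Finset.single_le_sum (f := fun k => (dist (x i₀) (x k))⁻¹ ^ 12)
      (fun k _ => by positivity) hj
  have hexp : siteEnergy lennardJones x i₀ =
      (1 / 12) * ∑ k ∈ Finset.univ.erase i₀, (dist (x i₀) (x k))⁻¹ ^ 12 -
        (1 / 6) * ∑ k ∈ Finset.univ.erase i₀, (dist (x i₀) (x k))⁻¹ ^ 6 := by
    simp only [siteEnergy, lennardJones, Finset.sum_sub_distrib, Finset.mul_sum]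
  have hu : (729 : ℝ) < r⁻¹ ^ 6 := by
    have h3 : 3 < r⁻¹ := by
      rw [lt_inv_comm₀ (by norm_num) hr]
      have : (3 : ℝ)⁻¹ = 1 / 3 := by norm_num
      linarith
    calc (729 : ℝ) = 3 ^ 6 := by norm_num
      _ < r⁻¹ ^ 6 := pow_lt_pow_left₀ h3 (by norm_num) (by norm_num)
  have h12' : r⁻¹ ^ 12 = (r⁻¹ ^ 6) ^ 2 := by ring
  have hu' : 729 * r⁻¹ ^ 6 < r⁻¹ ^ 6 * r⁻¹ ^ 6 := mul_lt_mul_of_pos_right hu (by linarith)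
  rw [h12', sq] at h12
  linarith

/-! ## The reductions -/

/-- **Separated star coercivity forces zero defect density** (conclusion = the body of
`ZeroDefectDensity` in the `defects` vocabulary, `zeroDefectDensity_iff`; stated this way so that no
registered obligation is concluded under an unregistered hypothesis — compose with
`zeroDefectDensity_iff.2`).  The hypothesis is the crux inequality of `StarCoercivity` demanded
only of `1/3`-SEPARATED injective configurations (the entry `SepStarCoercivity` of the crux line
`separation-padding-transfer`, the form its Regge/LP engine and the handover cards quantify over):
`N·e_per + g·#Def₁(x) − C·N^(2/3) ≤ E_LJ(x)`.  Proof: a ground state `x^N` is injective and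
`1/3`-separated (`third_le_dist_of_isGroundState`) with `E_LJ(x^N) = E(N)`, so the inequality holds
along every sequence of ground states; `E(N)/N → e_∞` (`BlancLewin2015_8_holds`) and
`limsup E(N)/N ≤ e_per` (`crysEnergyUpper_proof`, item 11865) give `e_∞ ≤ e_per`, and the squeeze
`coercivityForcesZeroDefects_squeeze` (glue file of item 13605) gives `#Def₁(x^N)/N → 0`.  So for
item 13604 the crux's closest-pair deletion (separation removal) is not needed. [folklore] -/
theorem tendsto_defects_div_of_sepStarCoercivity
    (h : ∃ g : ℝ, 0 < g ∧ ∃ C : ℝ, ∀ (N : ℕ) (x : Fin N → EuclideanSpace ℝ (Fin 3)),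
      Function.Injective x → (∀ i j : Fin N, i ≠ j → (1 / 3 : ℝ) ≤ dist (x i) (x j)) →
        (N : ℝ) * (⨅ Q : Literature.MathematicalPhysics.StatisticalMechanics.PeriodicConfiguration 3,
          Q.energyPerParticle Literature.MathematicalPhysics.StatisticalMechanics.lennardJones) +
        g * (Nat.card {i : Fin N // ¬ ∃ a : ℝ, 9 / 10 ≤ a ∧ a ≤ 11 / 10 ∧
          (Literature.Geometry.DiscreteGeometry.ShellCloseTo (1 / 20)
            ((Finset.univ.filter fun j : Fin N => j ≠ i ∧ dist (x i) (x j) ≤ 6 / 5).image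
              fun j => a⁻¹ • (x j - x i)) Literature.Geometry.DiscreteGeometry.fccKissingPattern ∨
          Literature.Geometry.DiscreteGeometry.ShellCloseTo (1 / 20)
            ((Finset.univ.filter fun j : Fin N => j ≠ i ∧ dist (x i) (x j) ≤ 6 / 5).image
              fun j => a⁻¹ • (x j - x i)) Literature.Geometry.DiscreteGeometry.hcpKissingPattern)} : ℝ) -
        C * (N : ℝ) ^ (2 / 3 : ℝ) ≤
        Literature.MathematicalPhysics.StatisticalMechanics.interactionEnergy
          Literature.MathematicalPhysics.StatisticalMechanics.lennardJones x) :
    ∀ x : (N : ℕ) → (Fin N → EuclideanSpace ℝ (Fin 3)), (∀ N, IsGroundState lennardJones (x N)) →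
      Tendsto (fun N : ℕ => (defects (x N) : ℝ) / N) atTop (𝓝 0) := by
  obtain ⟨g, hg, C, h⟩ := h
  intro x hx
  obtain ⟨e, -, hE, -⟩ := BlancLewin2015_8_holds 3 (by norm_num) (by norm_num)
  have hUp : limsup (fun N : ℕ => groundStateEnergy lennardJones 3 N / N) atTop ≤
      ⨅ Q : PeriodicConfiguration 3, Q.energyPerParticle lennardJones := crysEnergyUpper_proof
  have he : e ≤ ⨅ Q : PeriodicConfiguration 3, Q.energyPerParticle lennardJones :=
    hE.limsup_eq.ge.trans hUp
  refine coercivityForcesZeroDefects_squeeze (C := C) hg (fun N => Nat.cast_nonneg _)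
    (fun N => ?_) hE he
  obtain ⟨hinj, hEN⟩ := hx N
  have h1 := h N (x N) hinj fun i j hij => third_le_dist_of_isGroundState (hx N) hij
  rwa [hEN] at h1

/-- **The separated two-shell gap forces zero defect density** (same conclusion; compose with
`zeroDefectDensity_iff.2`).  The hypothesis is, verbatim, the registered stub
`stub_separatedTwoShellGap` of the crux line `separation-padding-transfer`
(crux stmt-AtomisticToContinuum-13600): `g > 0` and `C` such that every `1/3`-separated
configuration has `N·e_per + g·#Bad₂(x) − C·N^(2/3) ≤ E_LJ(x)`.  By `#Def₁ ≤ #Bad₂` on injective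
configurations (`defects_le_card_not_isTwoShellGood`) it gives the separated star inequality with
the same constants, whence `tendsto_defects_div_of_sepStarCoercivity`. [folklore] -/
theorem tendsto_defects_div_of_sepTwoShellGap
    (h : ∃ g : ℝ, 0 < g ∧ ∃ C : ℝ, ∀ (N : ℕ) (x : Fin N → EuclideanSpace ℝ (Fin 3)),
      (∀ i j : Fin N, i ≠ j → (1 / 3 : ℝ) ≤ dist (x i) (x j)) →
        (N : ℝ) * (⨅ Q : Literature.MathematicalPhysics.StatisticalMechanics.PeriodicConfiguration 3,
          Q.energyPerParticle Literature.MathematicalPhysics.StatisticalMechanics.lennardJones) +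
        g * (Nat.card {i : Fin N //
          ¬ Literature.Geometry.DiscreteGeometry.IsTwoShellGood (1 / 20) (47 / 50) 1 x i} : ℝ) -
        C * (N : ℝ) ^ (2 / 3 : ℝ) ≤
        Literature.MathematicalPhysics.StatisticalMechanics.interactionEnergy
          Literature.MathematicalPhysics.StatisticalMechanics.lennardJones x) :
    ∀ x : (N : ℕ) → (Fin N → EuclideanSpace ℝ (Fin 3)), (∀ N, IsGroundState lennardJones (x N)) →
      Tendsto (fun N : ℕ => (defects (x N) : ℝ) / N) atTop (𝓝 0) := by
  obtain ⟨g, hg, C, h⟩ := h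
  refine tendsto_defects_div_of_sepStarCoercivity ⟨g, hg, C, fun N x hinj hsep => ?_⟩
  have h1 := h N x hsep
  have h2 : (defects x : ℝ) ≤
      (Nat.card {i : Fin N // ¬ IsTwoShellGood (1 / 20) (47 / 50) 1 x i} : ℝ) := by
    exact_mod_cast defects_le_card_not_isTwoShellGood hinj
  have h3 := mul_le_mul_of_nonneg_left h2 hg.le
  show (N : ℝ) * _ + g * (defects x : ℝ) - _ ≤ _
  linarith

/-- **`CoerciveTwoShellGap → ZeroDefectDensity`**: the target of route `PhononSlackCertificates`
(stmt-AtomisticToContinuum-13956: for every `δ > 0` a coercive two-shell gap with `C = 0` on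
`δ`-separated configurations) implies item 13604, through its `δ = 1/3` instance and
`tendsto_defects_div_of_sepTwoShellGap`. Hence 13604 closes as soon as either the crux 13600
(`zeroDefectDensity_of_starCoercivity`) or the shared target 13956 lands. [folklore] -/
theorem zeroDefectDensity_of_coerciveTwoShellGap
    (h : Summit.AtomisticToContinuum.Crystallization.Theses.PhononSlackCertificates.CoerciveTwoShellGap) :
    ZeroDefectDensity := by
  obtain ⟨g, hg, hh⟩ := h (1 / 3) (by norm_num)
  exact zeroDefectDensity_iff.2 <| tendsto_defects_div_of_sepTwoShellGap
    ⟨g, hg, 0, fun N x hs => by simpa only [zero_mul, sub_zero] using hh N x hs⟩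

end Summit.AtomisticToContinuum.Crystallization.Theorems.ZeroDefectDensity

end
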